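import Summits.ResolutionOfSingularities.ResolutionOfSingularities.Theorems.ValuativeLuAlphaPTorsorAdaptedDefs
import Summits.ResolutionOfSingularities.ResolutionOfSingularities.Theorems.ValuativeLuAlphaPTorsorAdaptedUnimodularHelpers
import Summits.ResolutionOfSingularities.ResolutionOfSingularities.Theorems.ValuativeLuAlphaPTorsorAdaptedUnimodularLattice
import Mathlib
import HarnessLib

/-!
# `Valuative.LuAlphaPTorsor`, line `pfaff-line-log-final-forms`: flag-adapted unimodular re-parametrization of independent values (stub F¹)

Route `ResolutionOfSingularities/Valuative`, crux `Valuative.LuAlphaPTorsor`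
(stmt-ResolutionOfSingularities-0641), line `pfaff-line-log-final-forms`, stub
`stub_adaptedUnimodular` (reshape v6.3; consumed as a hypothesis by F³ `stub_adaptedHenselRootChart`
and F⁶ᵛ `stub_adaptedValueStep` of the rank `≥ 2` Abhyankar core).

**Statement.** For `ℤ`-independent non-zero values `τ₁, …, τₙ` in a linearly ordered commutative
group with zero and finitely many exponent vectors `h` with `τ^h ≤ 1`, there is `C ∈ GLₙ(ℤ)`
(inverse `D`) such that the new values `τ'ⱼ := ∏ᵢ τᵢ ^ C j i` are all `< 1`, every `h` is an
`ℕ`-combination of the rows of `C`, and `τ'` is FLAG-ADAPTED for some level map `lv`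
(`FlagAdaptedValues` of `…AdaptedDefs.lean` = `AdaptedValues` (C2a)(C2b)(C4) ∧ `LevelArchimedean`:
the levels are exactly the archimedean classes of the value lattice).

**Proof.** `adUni_main` — for a finitely generated linearly ordered abelian group `V` (the
lattice `ℤⁿ` ordered through the values, order reversed) and finitely many non-negative
elements: a basis of POSITIVE elements with a level map having non-negative coordinates for the
given elements and the structural properties (K1) (the lower levels span CONVEX subgroups) and
(K2) (each level is ONE archimedean class modulo the lower ones). Induction on the rank
(Zariski–Perron adapted to the convex flag): the elements infinitely smaller than the top
element `B = ∑ |bᵢ|` form a pure convex proper subgroup `L` (`…Helpers.lean`), cut out by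
coordinates of a Smith basis; Knaf–Kuhlmann 2005, Lemma 4.2 (PROVED,
`exists_basis_pos_forall_repr_nonneg` of `Literature/…/PerronTransforms.lean`) on a complement
of `L`, a type-2 shift of the new top vectors by a large low element making the low remainders
of the given elements non-negative (`adUni_top_block`), the induction hypothesis on `L` with
these remainders, and gluing (`…Lattice.lean`). `adUni_clauses` turns (K1), (K2) into the four
clauses, and `stub_adaptedUnimodular` transports everything to the matrix form through the
lattice `span ℤ {τᵢ} ⊆ Additive (Γ₀ˣ)ᵒᵈ` and the change-of-basis matrices.
-/

set_option linter.dupNamespace false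

namespace Summit.ResolutionOfSingularities.ResolutionOfSingularities.Theorems.PfaffLine

open Literature.AlgebraicGeometry.Resolution Module

section Main

/-- **Adapted positive bases of finitely generated ordered abelian groups** (Zariski–Perron
adapted to the convex flag). For a finitely generated linearly ordered abelian group `V` and
finitely many non-negative elements `D` there are a `ℤ`-basis `e` of POSITIVE elements and a
level map `lv` such that every `d ∈ D` has non-negative coordinates, (K1) a combination with a
non-zero coordinate at a level `≥ ℓ` dominates every multiple of every combination of the
members of level `< ℓ`, and (K2) a combination of members of level `≤ ℓ` with a non-zero
coordinate at level `ℓ` archimedean-dominates every combination of members of level `≤ ℓ`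
(the levels are exactly the archimedean classes, and each level spans a complement of the convex
subgroup generated by the lower ones). Induction on the rank: split off the top archimedean
class (`adUni_top_block`) from the convex subgroup of non-top elements, which is pure. -/
theorem adUni_main (n : ℕ) : ∀ (V : Type) [AddCommGroup V] [LinearOrder V]
    [IsOrderedAddMonoid V] [Module.Finite ℤ V], Module.finrank ℤ V = n →
    ∀ D : Finset V, (∀ d ∈ D, 0 ≤ d) →
    ∃ (ι : Type) (_ : Fintype ι) (e : Basis ι ℤ V) (lv : ι → ℕ),
      (∀ i, 0 < e i) ∧ (∀ d ∈ D, ∀ i, 0 ≤ e.repr d i) ∧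
      (∀ (ℓ : ℕ) (m μ : ι → ℤ), (∀ j, ℓ ≤ lv j → m j = 0) → (∃ j, ℓ ≤ lv j ∧ μ j ≠ 0) →
        ∀ N : ℕ, N • |∑ j, m j • e j| < |∑ j, μ j • e j|) ∧
      (∀ (ℓ : ℕ) (μ μ' : ι → ℤ), (∀ j, ℓ < lv j → μ j = 0) → (∃ j, lv j = ℓ ∧ μ j ≠ 0) →
        (∀ j, ℓ < lv j → μ' j = 0) → ∃ N : ℕ, |∑ j, μ' j • e j| ≤ N • |∑ j, μ j • e j|) := by
  induction n using Nat.strong_induction_on with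
  | _ n ih =>
  intro V _ _ _ _ hn D hD
  classical
  haveI : Module.Free ℤ V := Module.free_of_finite_type_torsion_free'
  let b₀ : Basis (Fin n) ℤ V := (Module.finBasis ℤ V).reindex (finCongr hn)
  rcases Nat.eq_zero_or_pos n with h0 | hpos
  · subst h0
    refine ⟨Fin 0, inferInstance, b₀, fun _ => 0, fun i => i.elim0, fun d _ i => i.elim0, ?_, ?_⟩
    · rintro ℓ m μ - ⟨j, -, -⟩ N
      exact j.elim0
    · rintro ℓ μ μ' - ⟨j, -, -⟩ -
      exact j.elim0
  -- the top element `B` and the convex subgroup `L` of the non-top elements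
  set B : V := ∑ i, |b₀ i| with hB
  have hBpos : 0 < B :=
    Finset.sum_pos (fun i _ => abs_pos.mpr (b₀.ne_zero i)) ⟨⟨0, hpos⟩, Finset.mem_univ _⟩
  have hbound : ∀ v, ∃ N : ℕ, |v| ≤ N • B := adUni_exists_bound b₀
  obtain ⟨L, hL⟩ := adUni_exists_low hBpos
  obtain ⟨r, bM, f, hLf, hrank⟩ :=
    adUni_pure_basis b₀ L (fun k hk v hv => adUni_low_pure hL hk hv)
  have hr : r < n := by
    have hBL := adUni_not_mem_low hL
    rw [hLf] at hBL
    push Not at hBL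
    obtain ⟨j₀, hj₀, -⟩ := hBL
    simpa using Fintype.card_lt_of_injective_of_notMem f f.injective hj₀
  obtain ⟨t, c, E, res, hcpos, hcind, hcspan, hres⟩ := adUni_top_block hL bM f hLf D hD
  -- the induction hypothesis on `L`
  set DL : Finset L := D.attach.image (fun d => ⟨res d.1, (hres d.1 d.2).1⟩) with hDL
  have hDLnn : ∀ y ∈ DL, 0 ≤ y := by
    intro y hy
    obtain ⟨d, -, rfl⟩ := Finset.mem_image.mp hy
    rw [← Subtype.coe_le_coe]
    exact (hres d.1 d.2).2.1
  obtain ⟨ιL, _, eL, lvL, hposL, hreprL, hK1L, hK2L⟩ := ih r hr L hrank DL hDLnn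
  -- glue
  obtain ⟨e, hinl, hinr⟩ := adUni_combine_basis eL c hcind hcspan
  set M : ℕ := Finset.univ.sup lvL + 1 with hM
  have hlvM : ∀ i, lvL i < M := fun i => Nat.lt_succ_of_le (Finset.le_sup (Finset.mem_univ i))
  refine ⟨ιL ⊕ Fin t, inferInstance, e, Sum.elim lvL (fun _ => M), ?_, ?_, ?_, ?_⟩
  · rintro (i | j)
    · rw [hinl, ← Submodule.coe_zero (p := L), Subtype.coe_lt_coe]  -- hmm
      exact hposL i
    · rw [hinr]
      exact hcpos j
  · intro d hd k
    refine adUni_combine_repr eL c e hinl hinr d (E d) (res d) (hres d hd).1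
      (fun i => hreprL _ ?_ i) (hres d hd).2.2 k
    exact Finset.mem_image.mpr ⟨⟨d, hd⟩, Finset.mem_attach _ _, rfl⟩
  · exact adUni_combine_K1 (fun v hv w hw N => adUni_low_lt hL hv hw N) eL lvL M hlvM c hcind e
      hinl hinr hK1L
  · exact adUni_combine_K2 (fun v hv w => adUni_top_arch hL hbound hv w) eL lvL M hlvM c hcind e
      hinl hinr hK2L

end Main

section Final

/-- Stub F¹ (reshape v6.3) of crux `Valuative.LuAlphaPTorsor`, line `pfaff-line-log-final-forms`:
**flag-adapted unimodular re-parametrization of a `ℤ`-independent family of values** — after a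
unimodular change `C` (inverse `D`) the new values `τ'ⱼ = ∏ᵢ τᵢ ^ C j i` are all `< 1`, finitely
many given Laurent monomials of value `≤ 1` become `ℕ`-monomials in them, and `τ'` is adapted to
the flag of convex subgroups of its lattice for some level map (`FlagAdaptedValues`). Pure
ordered-group theory (`adUni_main`, Zariski–Perron level by level with Knaf–Kuhlmann's
Lemma 4.2 on each archimedean quotient and type-2 rescaling). [folklore] -/
theorem stub_adaptedUnimodular :
    ∀ (Γ₀ : Type) [LinearOrderedCommGroupWithZero Γ₀] (n : ℕ) (τ : Fin n → Γ₀),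
    (∀ i, τ i ≠ 0) → (∀ m : Fin n → ℤ, (∏ i, τ i ^ (m i)) = 1 → m = 0) →
    ∀ (H : Finset (Fin n → ℤ)), (∀ h ∈ H, (∏ i, τ i ^ (h i)) ≤ 1) →
    ∃ (C D : Matrix (Fin n) (Fin n) ℤ), C * D = 1 ∧ D * C = 1 ∧
      (∀ j, (∏ i, τ i ^ (C j i)) < 1) ∧
      (∀ h ∈ H, ∃ e : Fin n → ℕ, ∀ i, h i = ∑ j, (e j : ℤ) * C j i) ∧
      ∃ lv : Fin n → ℕ, FlagAdaptedValues (fun j => ∏ i, τ i ^ (C j i)) lv := by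
  intro Γ₀ _ n τ hτ0 hind H hH
  classical
  -- values of the elements of the additive ordered group `W := Additive (Γ₀ˣ)ᵒᵈ`
  -- (order reversed, so that the values `< 1` are the positive elements)
  let val : Additive (Γ₀ˣ)ᵒᵈ → Γ₀ := fun w => ((OrderDual.ofDual (Additive.toMul w) : Γ₀ˣ) : Γ₀)
  have hval_sum : ∀ {ι : Type} (s : Finset ι) (g : ι → Additive (Γ₀ˣ)ᵒᵈ),
      val (∑ i ∈ s, g i) = ∏ i ∈ s, val (g i) := by
    intro ι s g
    simp only [val, toMul_sum]
    rw [← Units.coe_prod]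
    rfl
  have hval_zsmul : ∀ (z : ℤ) (w : Additive (Γ₀ˣ)ᵒᵈ), val (z • w) = val w ^ z := by
    intro z w
    simp only [val, toMul_zsmul]
    rw [← Units.val_zpow_eq_zpow_val]
    rfl
  have hval_nsmul : ∀ (k : ℕ) (w : Additive (Γ₀ˣ)ᵒᵈ), val (k • w) = val w ^ k := by
    intro k w
    simp only [val, toMul_nsmul]
    rw [← Units.val_pow_eq_pow_val]
    rfl
  have hval_lt : ∀ w w' : Additive (Γ₀ˣ)ᵒᵈ, w < w' ↔ val w' < val w := by
    intro w w'
    rw [← Additive.toMul_lt, ← OrderDual.ofDual_lt_ofDual, Units.val_lt_val]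
  have hval_le : ∀ w w' : Additive (Γ₀ˣ)ᵒᵈ, w ≤ w' ↔ val w' ≤ val w := by
    intro w w'
    rw [← Additive.toMul_le, ← OrderDual.ofDual_le_ofDual, Units.val_le_val]
  have hval_zero : val 0 = 1 := by simp [val]
  -- the generators and their lattice `V`
  let u' : Fin n → Additive (Γ₀ˣ)ᵒᵈ := fun i =>
    Additive.ofMul (OrderDual.toDual (Units.mk0 (τ i) (hτ0 i)))
  have hval_u' : ∀ i, val (u' i) = τ i := fun i => by simp [val, u']
  have hval_comb : ∀ m : Fin n → ℤ, val (∑ i, m i • u' i) = ∏ i, τ i ^ (m i) := fun m => by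
    rw [hval_sum]
    simp only [hval_zsmul, hval_u']
  have hli : LinearIndependent ℤ u' := by
    rw [Fintype.linearIndependent_iff]
    intro g hg i
    have h1 : (∏ i, τ i ^ (g i)) = 1 := by rw [← hval_comb, hg, hval_zero]
    exact congrFun (hind g h1) i
  let V : Submodule ℤ (Additive (Γ₀ˣ)ᵒᵈ) := Submodule.span ℤ (Set.range u')
  let bu : Basis (Fin n) ℤ V := Basis.span hli
  have hbu : ∀ i, (bu i : Additive (Γ₀ˣ)ᵒᵈ) = u' i := fun i => Basis.coe_span_apply hli i
  haveI : Module.Finite ℤ V := Module.Finite.of_basis bu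
  have hvalV : ∀ (ι : Type) [Fintype ι] (g : ι → V) (m : ι → ℤ),
      val ((∑ j, m j • g j : V) : Additive (Γ₀ˣ)ᵒᵈ) = ∏ j, val (g j) ^ (m j) := by
    intro ι _ g m
    push_cast
    rw [hval_sum]
    simp only [hval_zsmul]
  have hvalVn : ∀ (g : V) (k : ℕ),
      val ((k • g : V) : Additive (Γ₀ˣ)ᵒᵈ) = val (g : Additive (Γ₀ˣ)ᵒᵈ) ^ k := by
    intro g k
    push_cast
    exact hval_nsmul k _
  have hltV : ∀ g g' : V, g < g' ↔ val (g' : Additive (Γ₀ˣ)ᵒᵈ) < val (g : Additive (Γ₀ˣ)ᵒᵈ) :=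
    fun g g' => by rw [← Subtype.coe_lt_coe, hval_lt]
  -- the finite set of non-negative elements
  let dH : (Fin n → ℤ) → V := fun h => ∑ i, h i • bu i
  have hdH_val : ∀ h, val (dH h : Additive (Γ₀ˣ)ᵒᵈ) = ∏ i, τ i ^ (h i) := fun h => by
    simp only [dH]
    rw [hvalV]
    simp only [hbu, hval_u']
  have hD : ∀ d ∈ H.image dH, (0 : V) ≤ d := by
    intro d hd
    obtain ⟨h, hh, rfl⟩ := Finset.mem_image.mp hd
    rw [← Subtype.coe_le_coe, Submodule.coe_zero, hval_le, hdH_val, hval_zero]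
    exact hH h hh
  -- the adapted positive basis of the abstract theory
  obtain ⟨ι, _, e, lv, hpos, hrepr, hK1, hK2⟩ := adUni_main _ V rfl (H.image dH) hD
  let σ : ι ≃ Fin n := e.indexEquiv bu
  let e' : Basis (Fin n) ℤ V := e.reindex σ
  have he' : ∀ j, e' j = e (σ.symm j) := fun j => Basis.reindex_apply _ _ _
  obtain ⟨hK1', hK2'⟩ := adUni_reindex σ e lv hK1 hK2
  obtain ⟨hC2a, hC2b, hC4, hLA⟩ :=
    adUni_clauses (fun j => e (σ.symm j)) (fun j => lv (σ.symm j)) (fun j => hpos _) hK1' hK2'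
  -- the change-of-basis matrices
  let C : Matrix (Fin n) (Fin n) ℤ := (bu.toMatrix e').transpose
  let D : Matrix (Fin n) (Fin n) ℤ := (e'.toMatrix bu).transpose
  have hC : ∀ j i, C j i = bu.repr (e' j) i := fun j i => by
    simp only [C, Matrix.transpose_apply, Basis.toMatrix_apply]
  have hCD : C * D = 1 := by
    have h1 : e'.toMatrix bu * bu.toMatrix e' = 1 := Basis.toMatrix_mul_toMatrix_flip _ _
    have h2 := congrArg Matrix.transpose h1
    rwa [Matrix.transpose_mul, Matrix.transpose_one] at h2
  have hDC : D * C = 1 := by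
    have h1 : bu.toMatrix e' * e'.toMatrix bu = 1 := Basis.toMatrix_mul_toMatrix_flip _ _
    have h2 := congrArg Matrix.transpose h1
    rwa [Matrix.transpose_mul, Matrix.transpose_one] at h2
  -- the new values are the values of the new basis
  have hτ' : ∀ j, (∏ i, τ i ^ (C j i)) = val (e (σ.symm j) : Additive (Γ₀ˣ)ᵒᵈ) := fun j => by
    have : e (σ.symm j) = ∑ i, C j i • bu i := by
      simp only [hC]
      rw [← he']
      exact (bu.sum_repr (e' j)).symm
    rw [this, hvalV]
    simp only [hbu, hval_u']
  have hmon : ∀ m : Fin n → ℤ, (∏ j, (∏ i, τ i ^ (C j i)) ^ (m j)) =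
      val ((∑ j, m j • e (σ.symm j) : V) : Additive (Γ₀ˣ)ᵒᵈ) := fun m => by
    rw [hvalV]
    simp only [hτ']
  refine ⟨C, D, hCD, hDC, ?_, ?_, fun j => lv (σ.symm j), ⟨?_, ?_, ?_⟩, ?_⟩
  · -- all new values are `< 1`
    intro j
    rw [hτ', ← hval_zero, ← Submodule.coe_zero (p := V), ← hltV]
    exact hpos _
  · -- the given monomials become `ℕ`-monomials
    intro h hh
    have hd : dH h ∈ H.image dH := Finset.mem_image_of_mem _ hh
    have hnn : ∀ j, 0 ≤ e'.repr (dH h) j := fun j => by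
      rw [Basis.repr_reindex_apply]
      exact hrepr _ hd _
    refine ⟨fun j => (e'.repr (dH h) j).toNat, fun i => ?_⟩
    have h1 : dH h = ∑ j, (((e'.repr (dH h) j).toNat : ℕ) : ℤ) • e' j := by
      conv_lhs => rw [← e'.sum_repr (dH h)]
      refine Finset.sum_congr rfl fun j _ => ?_
      rw [Int.toNat_of_nonneg (hnn j)]
    have h3 : bu.repr (dH h) i = h i := by
      show bu.repr (∑ i, h i • bu i) i = h i
      rw [bu.repr_sum_self]
    rw [← h3]
    conv_lhs => rw [h1]
    simp only [map_sum, map_zsmul, Finsupp.coe_finsetSum, Finset.sum_apply, Finsupp.smul_apply,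
      smul_eq_mul, hC]
  · -- (C2a)
    intro i i' hii' m hm
    beta_reduce
    rw [hmon, hτ', ← hltV]
    exact hC2a i i' hii' m hm
  · -- (C2b)
    intro i i' hii'
    obtain ⟨N, hN⟩ := hC2b i i' hii'
    refine ⟨N, ?_⟩
    beta_reduce
    rw [hτ', hτ', ← hvalVn, ← hltV]
    exact hN
  · -- (C4)
    intro ℓ μ hμ hμ0
    beta_reduce
    rcases hC4 ℓ μ hμ hμ0 with h | h
    · left
      intro m hm
      rw [hmon, hmon, ← hltV]
      exact h m hm
    · right
      intro m hm
      rw [hmon, hmon, ← hltV]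
      exact h m hm
  · -- (LA) the levels are lattice-archimedean
    intro ℓ μ μ' hμ hμ' hlow
    beta_reduce at hlow ⊢
    obtain ⟨N, hN⟩ := hLA ℓ μ μ' hμ hμ' fun m hm => by
      have := hlow m hm
      rwa [hmon, hmon, ← hltV] at this
    refine ⟨N, ?_⟩
    rw [hmon, hmon, ← hvalVn, ← hltV]
    exact hN

end Final
end Summit.ResolutionOfSingularities.ResolutionOfSingularities.Theorems.PfaffLine
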